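import Summits.CriticalPhenomena.Ising3D.Control2DL15BoxUCells
import Summits.CriticalPhenomena.Ising3D.Control2DL15BoxURegion
import Mathlib.Tactic.Linarith
import Mathlib.Tactic.NormNum
import HarnessLib

/-!
# A kind-`box` 2D γ-certificate in the kernel: `Δ_ε ∉ [97/100, 39/40]` at `Δ_σ = 1/8` under `A2D′` (Λ = 15)
(cell `pub-ising3x`, seat controls-1 gen 18; KERNEL PATH for the 2D γ-certificates, Λ = 15 box kind — CONTROL-ONLY)

HONEST FRAMING: lottery ticket; floor = tightest certified 3D Ising CFT bounds; no exact-solution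
claim without a proof. CONTROL-ONLY: `d = 2`, global blocks, `Δ_σ = 1/8` exact, the 2D axiom set `A2D′`
(scalars of `σ × σ` in the `ε` box `∪ [2, ∞)`, stress tensor at `(2,2)` + spin-2 gap `1`, unitarity) — this
validates the kind-`box` certificate PIPELINE of the class-1 2D control on the exactly solved 2D Ising model
(`Δ_ε = 1`); nothing about `d = 3`.

**`excludedOn_2d_L15_boxU : ExcludedOn (1/8) 2 1 (Icc (97 / 100) (39 / 40))`** from the RB-2 certificate `j127796_functional_deriv2d_L15_E040_sig1o8_box0.97-0.975.json` (Λ = 15, E₀ = 40): Δ_ε ∉ [97/100, 39/40] at Δ_σ = 1/8 under A2D′,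
with EVERY obligation re-decided in the Lean kernel: (I) `ident_boxU`, (R) by `region_of_kernelCertAuto` applied HERE to the kernel facts
`cregboxU_n0` (`Control2DL15BoxURegion`) and `cregJboxU_ok` (`Control2DL15BoxUTable`) — no standalone `region_boxU` (gate dedup lint), cells `cells_boxU` (one integer polynomial
per spin from the literal library, Bernstein leaves). Zero grant compute. No facts, standard axioms only.
-/

namespace Summit.CriticalPhenomena.Ising3D.Control2D

open Finset Set
open Literature.MathematicalPhysics.QuantumFieldTheory.ConformalBootstrap3D

/-- **2D control, γ-architecture, kind `box`, kernel-complete: under `A2D′` at `Δ_σ = 1/8` no `ε` location in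
`[97/100, 39/40]` is possible**, every obligation of the Λ = 15 functional checked in the Lean kernel. CONTROL-ONLY
(d = 2). [cite: RattazziEtAl2008, §5.5] -/
theorem excludedOn_2d_L15_boxU : ExcludedOn (1 / 8 : ℝ) 2 1 (Icc (97 / 100 : ℝ) (39 / 40)) :=
  excludedOn_half_of_cellsN slL15.toFinset (fun p => (wtboxU p : ℝ)) (by norm_num) (by norm_num) (by norm_num)
    (by norm_num) (by norm_num) ident_boxU (region_of_kernelCertAuto wtboxU slL15_nodup slL15_deg 15 16 (by norm_num) (by norm_num) PregboxU_eq
      (by decide +kernel) QhatboxU_eq _ cregboxU_n0 cregJboxU (by decide) cregJboxU_ok) cells_boxU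

/-- **The same as a `BoxExcluded` statement** (the box lies above `2Δ_σ = 1/4`). [cite: RattazziEtAl2008, §5.5] -/
theorem boxExcluded_2d_L15_boxU : BoxExcluded (1 / 8 : ℝ) 2 1 (97 / 100) (39 / 40) :=
  boxExcluded_half_of_cellsN slL15.toFinset (fun p => (wtboxU p : ℝ)) (by norm_num) (by norm_num) (by norm_num)
    (by norm_num) (by norm_num) (by norm_num) ident_boxU (region_of_kernelCertAuto wtboxU slL15_nodup slL15_deg 15 16 (by norm_num) (by norm_num) PregboxU_eq
      (by decide +kernel) QhatboxU_eq _ cregboxU_n0 cregJboxU (by decide) cregJboxU_ok) cells_boxU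

end Summit.CriticalPhenomena.Ising3D.Control2D
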